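import Summits.Ventures.Crystal3D.Bulk.GapDegreesSharp
import Literature.Geometry.DiscreteGeometry.SphericalCodeContactGraph
import HarnessLib

/-!
# Two-level cone lemmas and the tight levels of an admissible fourteen-ball configuration
# (bricks of P-L3(a) planarity; Musin–Tarasov 2012 Prop. 3.1 adapted to two thresholds)

HONEST FRAMING. Part of the venture `Summits/Ventures/Crystal3D` (cell `pub-crystal3d`, phase 2,
24-hour sprint `PLAN.md` R42/R43; seat typer-bulk-2). Support file for `Bulk/GapPlanarity.lean`
(the two-level tight graph of every admissible configuration is a FAN in Hales's sense — row
P-L3a of the cell's `phase2/ENV-CENSUS/DESIGN-L12-THEORY.md`, a CORE row of the census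
completeness hypothesis `GapCensus.Complete` of `Bulk/GapCensusSkeleton.lean`). Two parts:

* PURE INNER-PRODUCT CONE LEMMAS (any real inner product space) at TWO contact levels — `t` for
  hole edges (a shell direction touching the hole direction `p` at the hole radius
  `ρ = arccos t`) and `κ` for contact edges (two shell directions at `arccos κ`; `κ = 1/2` in the
  application), cross pairs at inner product `≤` the relevant level — complementing the tree's
  one-level lemmas `Literature…SphericalCodeContactGraph.unit_eq_zero_of_edge_pair_pair /
  _shared / _ray` (Musin–Tarasov 2012, Prop. 3.1: "the shortest arcs `ab` and `xy` don't
  intersect. Otherwise, the length of at least one of the arcs `ax, ay, bx, by` has to be less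
  than `ψ(X)`"): `unit_eq_zero_of_holeEdge_pair` (a hole edge and a disjoint contact edge do not
  cross; `0 ≤ t`, `0 ≤ κ < 1`, `2t² < 1 + 2κ`), `unit_eq_zero_of_holeEdge_shared` (a hole edge and
  a contact edge at a common shell vertex overlap only in the vertex; `2t² < 1 + κ`, sharp),
  `unit_eq_zero_of_edge_pair_ray_twoLevel` (the hole direction is not on a contact arc;
  `2t² < 1 + κ`), `unit_eq_zero_of_holeEdge_ray` (no shell vertex on a hole arc; `t² < 1 + κ`).
  All proofs are three inner-product pairings and a sign argument — no trigonometry and no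
  triangle inequality on `S²`.
* THE THIRTEEN DIRECTIONS of a configuration `c : Fin 14 → ℝ³` seen from ball `0` (`gapDir c j`,
  unit vectors: the shell vectors `c j − c 0` and the hole direction) and the TIGHT LEVEL of a
  pair (`tightLevel c i j`: `1/2` shell–shell, `D/2` with `D = intruderDist c` if the intruder is
  involved), with, for every admissible configuration (`IsGapConfig`): separation
  `⟪gapDir c i, gapDir c j⟫ ≤ tightLevel c i j` (`IsGapConfig.inner_gapDir_le`), tightness
  `= tightLevel c i j` for touching balls (`IsGapConfig.inner_gapDir_eq`), and distinct balls
  have distinct directions when `D < 2` (`IsGapConfig.gapDir_ne`).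

Nothing is claimed about GAP(1.26).
-/

noncomputable section

open scoped BigOperators InnerProductSpace
open Finset Real

namespace Summit.Ventures.Crystal3D

open Literature.Geometry.DiscreteGeometry

/-! ## Two-level cone lemmas (any real inner product space) -/

section TwoLevelCone

variable {F : Type*} [NormedAddCommGroup F] [InnerProductSpace ℝ F]

/-- **A hole edge and a disjoint contact edge do not cross.** Unit vectors `p, a, c, d` with
`⟪p, a⟫ = t` (a hole edge: `a` touches the hole direction `p` at angular distance `ρ = arccos t`)
and `⟪c, d⟫ = κ` (a contact edge), the four cross pairs separated (`⟪p, c⟫, ⟪p, d⟫ ≤ t`,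
`⟪a, c⟫, ⟪a, d⟫ ≤ κ`), `0 ≤ t`, `0 ≤ κ < 1` and `2t² < 1 + 2κ`: if `s p + u a = s′ c + t′ d` with
all four coefficients `≥ 0` then all four vanish — the cones `C{p, a}` and `C{c, d}` meet only at
`0`. Proof: pairing the common point with `c + d`, with `p` and with `a` gives
`(1+κ)(s′+t′) ≤ 2ts + 2κu`, `s + ut ≤ t(s′+t′)`, `st + u ≤ κ(s′+t′)`, whence
`(1−κ)(1+2κ−2t²)(s′+t′) ≤ 0`. (Two-threshold form of Musin–Tarasov 2012, Prop. 3.1; cell file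
DESIGN-L12-THEORY P-L3(a).) -/
theorem unit_eq_zero_of_holeEdge_pair {p a c d : F} (hp : ‖p‖ = 1) (ha : ‖a‖ = 1) (hc : ‖c‖ = 1)
    (hd : ‖d‖ = 1) {t κ : ℝ} (ht0 : 0 ≤ t) (hκ0 : 0 ≤ κ) (hκ1 : κ < 1)
    (htκ : 2 * t ^ 2 < 1 + 2 * κ) (hpa : ⟪p, a⟫_ℝ = t) (hcd : ⟪c, d⟫_ℝ = κ) (hpc : ⟪p, c⟫_ℝ ≤ t)
    (hpd : ⟪p, d⟫_ℝ ≤ t) (hac : ⟪a, c⟫_ℝ ≤ κ) (had : ⟪a, d⟫_ℝ ≤ κ) {s u s' t' : ℝ} (hs : 0 ≤ s)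
    (hu : 0 ≤ u) (hs' : 0 ≤ s') (ht' : 0 ≤ t') (h : s • p + u • a = s' • c + t' • d) :
    s = 0 ∧ u = 0 ∧ s' = 0 ∧ t' = 0 := by
  have hpp : ⟪p, p⟫_ℝ = 1 := by rw [real_inner_self_eq_norm_sq, hp]; norm_num
  have haa : ⟪a, a⟫_ℝ = 1 := by rw [real_inner_self_eq_norm_sq, ha]; norm_num
  have hcc : ⟪c, c⟫_ℝ = 1 := by rw [real_inner_self_eq_norm_sq, hc]; norm_num
  have hdd : ⟪d, d⟫_ℝ = 1 := by rw [real_inner_self_eq_norm_sq, hd]; norm_num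
  have hap : ⟪a, p⟫_ℝ = t := by rw [real_inner_comm]; exact hpa
  have hdc : ⟪d, c⟫_ℝ = κ := by rw [real_inner_comm]; exact hcd
  have hcp : ⟪c, p⟫_ℝ ≤ t := by rw [real_inner_comm]; exact hpc
  have hdp : ⟪d, p⟫_ℝ ≤ t := by rw [real_inner_comm]; exact hpd
  have hca : ⟪c, a⟫_ℝ ≤ κ := by rw [real_inner_comm]; exact hac
  have hda : ⟪d, a⟫_ℝ ≤ κ := by rw [real_inner_comm]; exact had
  have e1 : ⟪s • p + u • a, c + d⟫_ℝ = ⟪s' • c + t' • d, c + d⟫_ℝ := by rw [h]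
  have e2 : ⟪s • p + u • a, p⟫_ℝ = ⟪s' • c + t' • d, p⟫_ℝ := by rw [h]
  have e3 : ⟪s • p + u • a, a⟫_ℝ = ⟪s' • c + t' • d, a⟫_ℝ := by rw [h]
  simp only [inner_add_left, inner_add_right, real_inner_smul_left, hpp, haa, hcc, hdd, hpa, hap,
    hcd, hdc] at e1 e2 e3
  have i1 : (1 + κ) * (s' + t') ≤ 2 * t * s + 2 * κ * u := by
    linarith [mul_le_mul_of_nonneg_left hpc hs, mul_le_mul_of_nonneg_left hpd hs,
      mul_le_mul_of_nonneg_left hac hu, mul_le_mul_of_nonneg_left had hu]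
  have i2 : s + u * t ≤ t * (s' + t') := by
    linarith [mul_le_mul_of_nonneg_left hcp hs', mul_le_mul_of_nonneg_left hdp ht']
  have i3 : s * t + u ≤ κ * (s' + t') := by
    linarith [mul_le_mul_of_nonneg_left hca hs', mul_le_mul_of_nonneg_left hda ht']
  have i2' := mul_le_mul_of_nonneg_left i2 (mul_nonneg (mul_nonneg zero_le_two ht0)
    (sub_nonneg.2 hκ1.le))
  have i3' := mul_le_mul_of_nonneg_left i3 (mul_nonneg zero_le_two hκ0)
  have hnn : 0 ≤ t ^ 2 * (1 - κ) * u := mul_nonneg (mul_nonneg (sq_nonneg t)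
    (sub_nonneg.2 hκ1.le)) hu
  have key : (1 - κ) * (1 + 2 * κ - 2 * t ^ 2) * (s' + t') ≤ 0 := by
    linarith [i1, i2', i3', hnn]
  have hpos : 0 < (1 - κ) * (1 + 2 * κ - 2 * t ^ 2) := mul_pos (by linarith) (by linarith)
  have hS : s' + t' ≤ 0 := by
    by_contra hlt
    have := mul_pos hpos (not_le.1 hlt)
    linarith
  have hs'0 : s' = 0 := by linarith
  have ht'0 : t' = 0 := by linarith
  rw [hs'0, ht'0] at i2 i3
  have hs0 : s = 0 := by linarith [mul_nonneg hu ht0]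
  have hu0 : u = 0 := by linarith [mul_nonneg hs ht0]
  exact ⟨hs0, hu0, hs'0, ht'0⟩

/-- **A hole edge and a contact edge at a common shell vertex overlap only in that vertex.** Unit
vectors `a, p, b` with `⟪a, p⟫ = t` (hole edge at `a`), `⟪a, b⟫ = κ` (contact edge at `a`) and
`⟪p, b⟫ ≤ t` (separation), `0 ≤ t`, `−1 < κ < 1`, `2t² < 1 + κ`: if `s a + u p = s′ a + t′ b`
with `u, t′ ≥ 0` then `u = t′ = 0` — `C{a, p} ∩ C{a, b} ⊆ C{a}`. Proof: pairing with `p`, `b`,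
`a` gives `st + u ≤ s′t + t′t`, `s′κ + t′ ≤ sκ + ut`, `s + ut = s′ + t′κ`; eliminating `s − s′`,
`u(1 − t²) ≤ t′t(1 − κ)` and `t′(1 + κ) ≤ ut`, whence `u(1 + κ − 2t²) ≤ 0`. The bound
`2t² < 1 + κ` is sharp (`κ = 1/2`: hole radius `> 30°`; at `30°` the hole direction can lie on
the contact arc). (Two-threshold form of Musin–Tarasov 2012, Prop. 3.1; DESIGN-L12-THEORY P-L3(a).)
-/
theorem unit_eq_zero_of_holeEdge_shared {a p b : F} (ha : ‖a‖ = 1) (hp : ‖p‖ = 1) (hb : ‖b‖ = 1)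
    {t κ : ℝ} (ht0 : 0 ≤ t) (hκ1 : κ < 1) (hκ2 : -1 < κ) (htκ : 2 * t ^ 2 < 1 + κ)
    (hap : ⟪a, p⟫_ℝ = t) (hab : ⟪a, b⟫_ℝ = κ) (hpb : ⟪p, b⟫_ℝ ≤ t) {s u s' t' : ℝ} (hu : 0 ≤ u)
    (ht' : 0 ≤ t') (h : s • a + u • p = s' • a + t' • b) : u = 0 ∧ t' = 0 := by
  have hpp : ⟪p, p⟫_ℝ = 1 := by rw [real_inner_self_eq_norm_sq, hp]; norm_num
  have haa : ⟪a, a⟫_ℝ = 1 := by rw [real_inner_self_eq_norm_sq, ha]; norm_num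
  have hbb : ⟪b, b⟫_ℝ = 1 := by rw [real_inner_self_eq_norm_sq, hb]; norm_num
  have hpa : ⟪p, a⟫_ℝ = t := by rw [real_inner_comm]; exact hap
  have hba : ⟪b, a⟫_ℝ = κ := by rw [real_inner_comm]; exact hab
  have hbp : ⟪b, p⟫_ℝ ≤ t := by rw [real_inner_comm]; exact hpb
  have e1 : ⟪s • a + u • p, p⟫_ℝ = ⟪s' • a + t' • b, p⟫_ℝ := by rw [h]
  have e2 : ⟪s • a + u • p, b⟫_ℝ = ⟪s' • a + t' • b, b⟫_ℝ := by rw [h]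
  have e3 : ⟪s • a + u • p, a⟫_ℝ = ⟪s' • a + t' • b, a⟫_ℝ := by rw [h]
  simp only [inner_add_left, real_inner_smul_left, hpp, haa, hbb, hap, hpa, hab, hba] at e1 e2 e3
  have i1 : s * t + u ≤ s' * t + t' * t := by linarith [mul_le_mul_of_nonneg_left hbp ht']
  have i2 : s' * κ + t' ≤ s * κ + u * t := by linarith [mul_le_mul_of_nonneg_left hpb hu]
  have hs_eq : s = s' + t' * κ - u * t := by linarith
  rw [hs_eq] at i1 i2
  have j1 : u * (1 - t ^ 2) ≤ t' * t * (1 - κ) := by linarith [i1]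
  have j2 : t' * (1 + κ) * (1 - κ) ≤ u * t * (1 - κ) := by linarith [i2]
  have j2' : t' * (1 + κ) ≤ u * t :=
    le_of_mul_le_mul_right j2 (by linarith : (0 : ℝ) < 1 - κ)
  have key : u * (1 + κ - 2 * t ^ 2) ≤ 0 := by
    linarith [mul_le_mul_of_nonneg_left j2' (mul_nonneg ht0 (sub_nonneg.2 hκ1.le)),
      mul_le_mul_of_nonneg_left j1 (by linarith : (0 : ℝ) ≤ 1 + κ)]
  have hu0 : u = 0 := by
    by_contra hne
    have := mul_pos (lt_of_le_of_ne hu (Ne.symm hne)) (by linarith : (0 : ℝ) < 1 + κ - 2 * t ^ 2)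
    linarith
  refine ⟨hu0, ?_⟩
  rw [hu0, zero_mul] at j2'
  have ht'le : t' ≤ 0 :=
    le_of_mul_le_mul_right (by linarith [j2'] : t' * (1 + κ) ≤ 0 * (1 + κ))
      (by linarith : (0 : ℝ) < 1 + κ)
  exact le_antisymm ht'le ht' 

/-- **The hole direction does not lie on a contact arc; more generally a contact edge and the
ray of a direction separated from both ends at a LOWER level meet only at `0`.** Unit vectors
`a, b, c` with `⟪a, b⟫ = κ` (a contact edge), `⟪a, c⟫, ⟪b, c⟫ ≤ t` with `2t² < 1 + κ`: if `s a + u b = r c` with `s, u, r ≥ 0` then `r = s = u = 0`. Proof as the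
tree's `unit_eq_zero_of_edge_pair_ray` (the case `t = κ`): `r ≤ t(s + u)` and
`r² = (1+κ)/2 (s+u)² + (1−κ)/2 (s−u)²`. (DESIGN-L12-THEORY P-L3(a), the hole direction `p` against
a shell–shell contact arc: `κ = 1/2`, `t = cos ρ`, valid for hole radius `ρ > 30°`.) -/
theorem unit_eq_zero_of_edge_pair_ray_twoLevel {a b c : F} (ha : ‖a‖ = 1) (hb : ‖b‖ = 1)
    (hc : ‖c‖ = 1) {κ t : ℝ} (htκ : 2 * t ^ 2 < 1 + κ)
    (hab : ⟪a, b⟫_ℝ = κ) (hac : ⟪a, c⟫_ℝ ≤ t) (hbc : ⟪b, c⟫_ℝ ≤ t) {s u r : ℝ} (hs : 0 ≤ s)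
    (hu : 0 ≤ u) (hr : 0 ≤ r) (h : s • a + u • b = r • c) : r = 0 ∧ s = 0 ∧ u = 0 := by
  have hκ1 : κ ≤ 1 := by
    rw [← hab]
    calc ⟪a, b⟫_ℝ ≤ ‖a‖ * ‖b‖ := real_inner_le_norm _ _
      _ = 1 := by rw [ha, hb, mul_one]
  set N := ⟪s • a + u • b, s • a + u • b⟫_ℝ with hN
  have hN1 : N = s ^ 2 + u ^ 2 + 2 * s * u * κ := by
    rw [hN, inner_self_comb_unit ha hb, hab]
  have hcc : ⟪c, c⟫_ℝ = 1 := by rw [real_inner_self_eq_norm_sq, hc]; norm_num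
  have hN2 : N = r ^ 2 := by
    rw [hN, h, real_inner_smul_left, real_inner_smul_right, hcc]; ring
  have hr1 : r = ⟪s • a + u • b, c⟫_ℝ := by
    rw [h, real_inner_smul_left, hcc, mul_one]
  have hr2 : r ≤ t * (s + u) := by
    rw [hr1]
    simp only [inner_add_left, real_inner_smul_left]
    nlinarith [mul_le_mul_of_nonneg_left hac hs, mul_le_mul_of_nonneg_left hbc hu]
  have hr3 : r ^ 2 ≤ (t * (s + u)) ^ 2 := pow_le_pow_left₀ hr hr2 2
  have hsos : N = (1 + κ) / 2 * (s + u) ^ 2 + (1 - κ) / 2 * (s - u) ^ 2 := by rw [hN1]; ring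
  have h2 : 0 ≤ (1 - κ) / 2 * (s - u) ^ 2 := mul_nonneg (by linarith) (sq_nonneg _)
  have key : (1 + κ - 2 * t ^ 2) * (s + u) ^ 2 ≤ 0 := by nlinarith
  have hpos : 0 < 1 + κ - 2 * t ^ 2 := by linarith
  have hsq : (s + u) ^ 2 ≤ 0 := by
    by_contra hlt
    have := mul_pos hpos (not_le.1 hlt)
    linarith
  have hsu : s + u = 0 := pow_eq_zero_iff two_ne_zero |>.1 (le_antisymm hsq (sq_nonneg _))
  have hs0 : s = 0 := by linarith
  have hu0 : u = 0 := by linarith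
  subst hs0; subst hu0
  have : r ^ 2 = 0 := by rw [← hN2, hN]; simp
  exact ⟨pow_eq_zero_iff two_ne_zero |>.1 this, rfl, rfl⟩

/-- **No shell vertex lies on a hole arc: a hole edge and the ray of a third direction meet only
at `0`.** Unit vectors `p, a, c` with `⟪p, a⟫ = t` (hole edge), `⟪p, c⟫ ≤ t`, `⟪a, c⟫ ≤ κ`,
`0 ≤ t`, `0 ≤ κ < 1`, `t² < 1 + κ`: if `s p + u a = r c` with `s, u, r ≥ 0` then `r = s = u = 0`.
Proof: pairing with `c`, `a`, `p` gives `r ≤ st + uκ`, `st + u ≤ rκ`, `s + ut ≤ rt`, whence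
`r(1−κ)(1+κ−t²) ≤ 0`. (DESIGN-L12-THEORY P-L3(a): a shell direction against a hole arc, `κ = 1/2`.)
-/
theorem unit_eq_zero_of_holeEdge_ray {p a c : F} (hp : ‖p‖ = 1) (ha : ‖a‖ = 1) (hc : ‖c‖ = 1)
    {t κ : ℝ} (ht0 : 0 ≤ t) (hκ0 : 0 ≤ κ) (hκ1 : κ < 1) (htκ : t ^ 2 < 1 + κ)
    (hpa : ⟪p, a⟫_ℝ = t) (hpc : ⟪p, c⟫_ℝ ≤ t) (hac : ⟪a, c⟫_ℝ ≤ κ) {s u r : ℝ} (hs : 0 ≤ s)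
    (hu : 0 ≤ u) (hr : 0 ≤ r) (h : s • p + u • a = r • c) : r = 0 ∧ s = 0 ∧ u = 0 := by
  have hpp : ⟪p, p⟫_ℝ = 1 := by rw [real_inner_self_eq_norm_sq, hp]; norm_num
  have haa : ⟪a, a⟫_ℝ = 1 := by rw [real_inner_self_eq_norm_sq, ha]; norm_num
  have hcc : ⟪c, c⟫_ℝ = 1 := by rw [real_inner_self_eq_norm_sq, hc]; norm_num
  have hap : ⟪a, p⟫_ℝ = t := by rw [real_inner_comm]; exact hpa
  have hca : ⟪c, a⟫_ℝ ≤ κ := by rw [real_inner_comm]; exact hac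
  have hcp : ⟪c, p⟫_ℝ ≤ t := by rw [real_inner_comm]; exact hpc
  have e1 : ⟪s • p + u • a, c⟫_ℝ = ⟪r • c, c⟫_ℝ := by rw [h]
  have e2 : ⟪s • p + u • a, a⟫_ℝ = ⟪r • c, a⟫_ℝ := by rw [h]
  have e3 : ⟪s • p + u • a, p⟫_ℝ = ⟪r • c, p⟫_ℝ := by rw [h]
  simp only [inner_add_left, real_inner_smul_left, hpp, haa, hcc, hpa, hap] at e1 e2 e3
  have k1 : r ≤ s * t + u * κ := by
    linarith [mul_le_mul_of_nonneg_left hpc hs, mul_le_mul_of_nonneg_left hac hu]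
  have k2 : s * t + u ≤ r * κ := by linarith [mul_le_mul_of_nonneg_left hca hr]
  have k3 : s + u * t ≤ r * t := by linarith [mul_le_mul_of_nonneg_left hcp hr]
  have k2' := mul_le_mul_of_nonneg_left k2 hκ0
  have k3' := mul_le_mul_of_nonneg_left k3 (mul_nonneg ht0 (sub_nonneg.2 hκ1.le))
  have hnn : 0 ≤ t ^ 2 * (1 - κ) * u := mul_nonneg (mul_nonneg (sq_nonneg t)
    (sub_nonneg.2 hκ1.le)) hu
  have key : r * ((1 - κ) * (1 + κ - t ^ 2)) ≤ 0 := by linarith [k1, k2', k3', hnn]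
  have hpos : 0 < (1 - κ) * (1 + κ - t ^ 2) := mul_pos (by linarith) (by linarith)
  have hr0 : r = 0 := by
    by_contra hne
    have := mul_pos (lt_of_le_of_ne hr (Ne.symm hne)) hpos
    linarith
  rw [hr0, zero_mul] at k2 k3
  have hs0 : s = 0 := by linarith [mul_nonneg hu ht0]
  have hu0 : u = 0 := by linarith [mul_nonneg hs ht0]
  exact ⟨hr0, hs0, hu0⟩

end TwoLevelCone

/-! ## The thirteen directions of an admissible configuration and their tight levels -/

section Config

variable {c : Fin 14 → EuclideanSpace ℝ (Fin 3)}

/-- The **direction of ball `j` seen from ball `0`**: the unit vector `‖c j − c 0‖⁻¹ • (c j − c 0)`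
(for a shell ball `j ∉ {0, 13}` of an admissible configuration this is `c j − c 0` itself,
`IsGapConfig.gapDir_of_shell`; for `j = 13` it is the hole direction `p` of the cell's files). -/
def gapDir (c : Fin 14 → EuclideanSpace ℝ (Fin 3)) (j : Fin 14) : EuclideanSpace ℝ (Fin 3) :=
  ‖c j - c 0‖⁻¹ • (c j - c 0)

/-- Directions are unit vectors. -/
theorem IsGapConfig.norm_gapDir (hc : IsGapConfig c) {j : Fin 14} (hj0 : j ≠ 0) :
    ‖gapDir c j‖ = 1 :=
  hc.norm_dir hj0

/-- The direction of a shell ball is its recentred centre. -/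
theorem IsGapConfig.gapDir_of_shell (hc : IsGapConfig c) {j : Fin 14} (hj0 : j ≠ 0)
    (hj13 : j ≠ 13) : gapDir c j = c j - c 0 :=
  hc.dir_eq_of_shell hj0 hj13

/-- The **tight level** of a pair of balls of a configuration: `1/2` for two shell balls (touching
shell balls have directions at `60°`), `D/2` with `D = intruderDist c` if one of them is the
intruder (a shell ball touching the intruder has its direction at inner product `D/2` with the
hole direction, i.e. at the hole radius `ρ = arccos (D/2)` from it). -/
def tightLevel (c : Fin 14 → EuclideanSpace ℝ (Fin 3)) (i j : Fin 14) : ℝ :=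
  if i = 13 ∨ j = 13 then intruderDist c / 2 else 1 / 2

/-- The tight level is symmetric. -/
theorem tightLevel_comm (c : Fin 14 → EuclideanSpace ℝ (Fin 3)) (i j : Fin 14) :
    tightLevel c i j = tightLevel c j i := by
  unfold tightLevel
  by_cases hi : i = 13 <;> by_cases hj : j = 13 <;> simp [hi, hj]

/-- The tight level of a pair involving the intruder (left). -/
theorem tightLevel_of_left (c : Fin 14 → EuclideanSpace ℝ (Fin 3)) (j : Fin 14) :
    tightLevel c 13 j = intruderDist c / 2 := by
  unfold tightLevel; rw [if_pos (Or.inl rfl)]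

/-- The tight level of a pair involving the intruder (right). -/
theorem tightLevel_of_right (c : Fin 14 → EuclideanSpace ℝ (Fin 3)) (i : Fin 14) :
    tightLevel c i 13 = intruderDist c / 2 := by
  unfold tightLevel; rw [if_pos (Or.inr rfl)]

/-- The tight level of two shell balls. -/
theorem tightLevel_of_ne {i j : Fin 14} (hi : i ≠ 13) (hj : j ≠ 13)
    (c : Fin 14 → EuclideanSpace ℝ (Fin 3)) : tightLevel c i j = 1 / 2 := by
  unfold tightLevel; rw [if_neg (not_or.2 ⟨hi, hj⟩)]

/-- Tight levels are `≥ 1/2` (the intruder is at distance `≥ 1` from ball `0`). -/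
theorem IsGapConfig.half_le_tightLevel (hc : IsGapConfig c) (i j : Fin 14) :
    1 / 2 ≤ tightLevel c i j := by
  unfold tightLevel
  split_ifs
  · linarith [hc.one_le_intruderDist]
  · exact le_rfl

/-- Tight levels are `< 1` when the intruder distance is `< 2`. -/
theorem tightLevel_lt_one (hD : intruderDist c < 2) (i j : Fin 14) : tightLevel c i j < 1 := by
  unfold tightLevel
  split_ifs
  · linarith
  · norm_num

/-- **Separation.** Two distinct balls other than ball `0` have directions at inner product at
most their tight level (shell–shell: `≤ 1/2`, `IsGapConfig.inner_sub_le_half`; shell–intruder: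
`≤ D/2`, `IsGapConfig.inner_dir_intruder_le`). -/
theorem IsGapConfig.inner_gapDir_le (hc : IsGapConfig c) {i j : Fin 14} (hi0 : i ≠ 0) (hj0 : j ≠ 0)
    (hij : i ≠ j) : ⟪gapDir c i, gapDir c j⟫_ℝ ≤ tightLevel c i j := by
  by_cases hi13 : i = 13
  · subst hi13
    have hj13 : j ≠ 13 := fun h => hij h.symm
    rw [tightLevel_of_left, hc.gapDir_of_shell hj0 hj13, real_inner_comm]
    exact hc.inner_dir_intruder_le hj0 hj13
  by_cases hj13 : j = 13
  · subst hj13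
    rw [tightLevel_of_right, hc.gapDir_of_shell hi0 hi13]
    exact hc.inner_dir_intruder_le hi0 hi13
  rw [tightLevel_of_ne hi13 hj13, hc.gapDir_of_shell hi0 hi13, hc.gapDir_of_shell hj0 hj13]
  exact hc.inner_sub_le_half hi0 hi13 hj0 hj13 hij

/-- **Tightness.** Two touching balls other than ball `0` have directions at inner product
exactly their tight level (shell–shell: `1/2`, `IsGapConfig.inner_sub_eq_half`; shell–intruder:
`D/2`, `IsGapConfig.inner_dir_intruder_of_touch`). -/
theorem IsGapConfig.inner_gapDir_eq (hc : IsGapConfig c) {i j : Fin 14} (hi0 : i ≠ 0) (hj0 : j ≠ 0)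
    (hd : dist (c i) (c j) = 1) : ⟪gapDir c i, gapDir c j⟫_ℝ = tightLevel c i j := by
  have hij : i ≠ j := by
    rintro rfl
    rw [dist_self] at hd
    exact zero_ne_one hd
  by_cases hi13 : i = 13
  · subst hi13
    have hj13 : j ≠ 13 := fun h => hij h.symm
    rw [tightLevel_of_left, hc.gapDir_of_shell hj0 hj13, real_inner_comm]
    exact hc.inner_dir_intruder_of_touch hj0 hj13 (by rw [dist_comm]; exact hd)
  by_cases hj13 : j = 13
  · subst hj13
    rw [tightLevel_of_right, hc.gapDir_of_shell hi0 hi13]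
    exact hc.inner_dir_intruder_of_touch hi0 hi13 hd
  rw [tightLevel_of_ne hi13 hj13, hc.gapDir_of_shell hi0 hi13, hc.gapDir_of_shell hj0 hj13]
  exact hc.inner_sub_eq_half hi0 hi13 hj0 hj13 hd

/-- **Distinct balls have distinct directions** (intruder distance `< 2`; at `D ≥ 2` the hole
direction may coincide with a shell direction). -/
theorem IsGapConfig.gapDir_ne (hc : IsGapConfig c) (hD : intruderDist c < 2) {i j : Fin 14}
    (hi0 : i ≠ 0) (hj0 : j ≠ 0) (hij : i ≠ j) : gapDir c i ≠ gapDir c j := by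
  intro h
  have h1 := hc.inner_gapDir_le hi0 hj0 hij
  rw [h, real_inner_self_eq_norm_sq, hc.norm_gapDir hj0, one_pow] at h1
  linarith [tightLevel_lt_one hD i j]

/-- Touching balls are distinct. -/
theorem index_ne_of_dist_eq_one {i j : Fin 14} (hd : dist (c i) (c j) = 1) : i ≠ j := by
  rintro rfl
  rw [dist_self] at hd
  exact zero_ne_one hd

end Config

end Summit.Ventures.Crystal3D
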